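import Literature.Analysis.UnboundedOperators.HeatKernel
import HarnessLib

/-!
# The heat semigroup on data integrable against Gaussians

Analysis/UnboundedOperators support file for the restart fact `oseenMild_restart` of
`Literature/Analysis/FluidPDE/NSBoundedMildOseen.lean` (Koch–Nadirashvili–Seregin–Šverák 2009,
§4: the integral equation `u = U + B(u,u)`, `U = e^{νtΔ}u₀`, "as an ODE in `t`"). There the
datum `u₀` of a Besov mild solution is not in any `Lᵖ`; all one knows is that it is measurable
and **integrable against every centred Gaussian**, `∫ G_a(y) ‖u₀(y)‖ dy < ∞` for all `a > 0`
(`G_a = heatKernel a` the Gauss–Weierstrass kernel). This file extends the basic calculus of the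
caloric extension `e^{tΔ}f = heatExtension f t = G_t ⋆ f` (`HeatKernel.lean`, stated there for
`f ∈ Lᵖ`) to this class. Everything is **proved**:

* `heatKernel_sub_le_mul_heatKernel_two_mul`: off-centre Gaussians are dominated by centred ones,
  `G_a(x - y) ≤ 2^{d/2} e^{‖x‖²/(4a)} G_{2a}(y)` (from `‖y‖² ≤ 2‖x - y‖² + 2‖x‖²`);
* `integrable_heatKernel_sub_mul_norm`, `integrable_heatKernel_mul_norm_sub`,
  `integrable_heatKernel_smul_sub`: hence such `f` is integrable against every Gaussian centred
  anywhere, and the convolution integral `e^{aΔ}f(x) = ∫ G_a(y) f(x - y) dy` converges absolutely at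
  **every** point, for every `a > 0`;
* `heatExtension_congr_ae'`: a.e. equal data have the same caloric extension everywhere;
  `heatExtension_sub_apply_of_integrable`, `heatExtension_add_apply_of_integrable`: additivity
  at a point where both convolution integrals converge;
* `integrable_heatKernel_mul_convolution_norm`: the Tonelli computation
  `∫ G_t(y) (G_s ⋆ ‖f‖)(x - y) dy = ∫ G_{s+t}(w) ‖f(x - w)‖ dw < ∞`;
* `heatExtension_heatExtension_of_integrable_heatKernel_mul_norm`: **the semigroup law**
  `e^{tΔ}(e^{sΔ}f) = e^{(s+t)Δ}f`, everywhere in space, for `s, t > 0` and `f` measurable and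
  integrable against Gaussians (associativity of convolution, `MeasureTheory.convolution_assoc`,
  whose side conditions are exactly the two previous items, and the kernel semigroup law
  `G_t ⋆ G_s = G_{s+t}`, `heatKernel_convolution_heatKernel_holds`) — the computation of
  Evans, *PDE*, §2.3.1 / Applebaum, *Semigroups of Linear Operators*, Thm. 3.1.4, carried out in
  the largest class on which the Gaussian convolution is absolutely convergent.

## Mathlib / tree search

Tree: `heatExtension_add_holds` (the `Lᵖ` case, `HeatKernel.lean`), `heatExtension_congr_ae`
(`FluidPDE/MildL3Smooth.lean`, same statement as `heatExtension_congr_ae'` but behind heavy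
imports), `heatExtension_add/sub_of_bound` (`HeatKernelBoundedData`, continuous bounded data);
nothing for Gaussian-integrable data (`lean search 'heatKernel . (x - y) ≤|Gaussian.*integrable.*heatExtension'`).
Mathlib: `MeasureTheory.convolution_assoc`, `AEStronglyMeasurable.convolution_integrand`,
`lintegral_lintegral_swap`, `lintegral_add_right_eq_self`, `integrable_comp_sub_left`,
`ofReal_integral_eq_lintegral_ofReal`, `quasiMeasurePreserving_sub_left`, `norm_add_sq_le`.

## References

* L. C. Evans, *Partial Differential Equations*, 2nd ed., AMS 2010, §2.3.1 (12) and Thm. 1.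
  [Evans2010]
* D. Applebaum, *Semigroups of Linear Operators*, CUP 2019, §3.1.1, Thm. 3.1.4 (p. 48).
  [Applebaum2019]
* G. Koch, N. Nadirashvili, G. Seregin, V. Šverák, Acta Math. 203 (2009) 83–105 =
  arXiv:0709.3599, §4 p. 8. [KochNadirashviliSereginSverak2009]
-/

noncomputable section

open MeasureTheory Set Function Filter Topology Metric Real
open scoped ENNReal NNReal Convolution

namespace Literature.Analysis.UnboundedOperators

variable {E : Type*} [NormedAddCommGroup E] [InnerProductSpace ℝ E] [FiniteDimensional ℝ E]
  [MeasurableSpace E] [BorelSpace E]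
variable {F : Type*} [NormedAddCommGroup F] [NormedSpace ℝ F]

/-! ## Off-centre Gaussians are dominated by centred ones -/

section Domination

omit [FiniteDimensional ℝ E] [MeasurableSpace E] [BorelSpace E] in
/-- **Off-centre domination of the heat kernel**: for `a > 0` and all `x, y`,
`G_a(x - y) ≤ 2^{d/2} e^{‖x‖²/(4a)} G_{2a}(y)` (`d = dim E`), from `‖y‖² ≤ 2‖x - y‖² + 2‖x‖²`,
i.e. `-‖x - y‖²/(4a) ≤ -‖y‖²/(8a) + ‖x‖²/(4a)`, and `(4πa)^{-d/2} = 2^{d/2} (8πa)^{-d/2}`.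
Evans, *PDE*, §2.3.1. [folklore] -/
theorem heatKernel_sub_le_mul_heatKernel_two_mul {a : ℝ} (ha : 0 < a) (x y : E) :
    heatKernel a (x - y) ≤
      (2 : ℝ) ^ ((Module.finrank ℝ E : ℝ) / 2) * Real.exp (‖x‖ ^ 2 / (4 * a)) *
        heatKernel (2 * a) y := by
  set d : ℝ := (Module.finrank ℝ E : ℝ) with hd
  have h4a : (0 : ℝ) < 4 * π * a := by positivity
  -- the exponents
  have hsq : ‖y‖ ^ 2 ≤ 2 * ‖x - y‖ ^ 2 + 2 * ‖x‖ ^ 2 := by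
    have htri : ‖y‖ ≤ ‖x - y‖ + ‖x‖ := by
      calc ‖y‖ = ‖x - (x - y)‖ := by rw [sub_sub_cancel]
        _ ≤ ‖x‖ + ‖x - y‖ := norm_sub_le _ _
        _ = ‖x - y‖ + ‖x‖ := add_comm _ _
    nlinarith [norm_nonneg y, norm_nonneg (x - y), norm_nonneg x, sq_nonneg (‖x - y‖ - ‖x‖)]
  have hexp : Real.exp (-‖x - y‖ ^ 2 / (4 * a)) ≤
      Real.exp (‖x‖ ^ 2 / (4 * a)) * Real.exp (-‖y‖ ^ 2 / (4 * (2 * a))) := by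
    rw [← Real.exp_add]
    refine Real.exp_le_exp.2 ?_
    rw [div_add_div _ _ (by positivity) (by positivity), div_le_div_iff₀ (by positivity) (by positivity)]
    have ha2 : 0 < a ^ 2 := by positivity
    nlinarith [mul_le_mul_of_nonneg_left hsq ha2.le]
  -- the normalising constants
  have hconst : (4 * π * a) ^ (-d / 2) = (2 : ℝ) ^ (d / 2) * (4 * π * (2 * a)) ^ (-d / 2) := by
    rw [show 4 * π * (2 * a) = 2 * (4 * π * a) by ring,
      Real.mul_rpow (by norm_num : (0 : ℝ) ≤ 2) h4a.le, ← mul_assoc,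
      show -d / 2 = -(d / 2) by ring, Real.rpow_neg (by norm_num : (0 : ℝ) ≤ 2),
      mul_inv_cancel₀ (by positivity), one_mul]
  rw [heatKernel, heatKernel, hconst]
  calc (2 : ℝ) ^ (d / 2) * (4 * π * (2 * a)) ^ (-d / 2) * Real.exp (-‖x - y‖ ^ 2 / (4 * a))
      ≤ (2 : ℝ) ^ (d / 2) * (4 * π * (2 * a)) ^ (-d / 2) *
          (Real.exp (‖x‖ ^ 2 / (4 * a)) * Real.exp (-‖y‖ ^ 2 / (4 * (2 * a)))) := by
        gcongr
    _ = (2 : ℝ) ^ (d / 2) * Real.exp (‖x‖ ^ 2 / (4 * a)) *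
          ((4 * π * (2 * a)) ^ (-d / 2) * Real.exp (-‖y‖ ^ 2 / (4 * (2 * a)))) := by ring

end Domination

/-! ## Gaussian integrability off centre; absolute convergence of the caloric extension -/

section Integrability

omit [NormedSpace ℝ F] in
/-- **Data integrable against centred Gaussians are integrable against all Gaussians**: if
`∫ G_a(y) ‖f(y)‖ dy < ∞` for every `a > 0` then `y ↦ G_a(x - y) ‖f(y)‖` is integrable for every
`a > 0` and every centre `x` (domination by `2^{d/2} e^{‖x‖²/(4a)} G_{2a}(y) ‖f(y)‖`). [folklore] -/
theorem integrable_heatKernel_sub_mul_norm {f : E → F} (hf : AEStronglyMeasurable f volume)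
    (hG : ∀ a : ℝ, 0 < a → Integrable (fun y => heatKernel a y * ‖f y‖) volume)
    {a : ℝ} (ha : 0 < a) (x : E) :
    Integrable (fun y => heatKernel a (x - y) * ‖f y‖) volume := by
  set C : ℝ := (2 : ℝ) ^ ((Module.finrank ℝ E : ℝ) / 2) * Real.exp (‖x‖ ^ 2 / (4 * a)) with hC
  refine ((hG (2 * a) (by positivity)).const_mul C).mono'
    (((continuous_heatKernel a).comp (continuous_const.sub continuous_id)).aestronglyMeasurable.mul
      hf.norm) (Eventually.of_forall fun y => ?_)
  rw [Real.norm_of_nonneg (mul_nonneg (heatKernel_pos ha _).le (norm_nonneg _)), ← mul_assoc]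
  exact mul_le_mul_of_nonneg_right (heatKernel_sub_le_mul_heatKernel_two_mul ha x y)
    (norm_nonneg _)

omit [NormedSpace ℝ F] in
/-- The reflected form: `y ↦ G_a(y) ‖f(x - y)‖` is integrable for every `a > 0`, `x ∈ E`, when
`f` is measurable and integrable against centred Gaussians (substitute `y ↦ x - y`). [folklore] -/
theorem integrable_heatKernel_mul_norm_sub {f : E → F} (hf : AEStronglyMeasurable f volume)
    (hG : ∀ a : ℝ, 0 < a → Integrable (fun y => heatKernel a y * ‖f y‖) volume)
    {a : ℝ} (ha : 0 < a) (x : E) :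
    Integrable (fun y => heatKernel a y * ‖f (x - y)‖) volume := by
  have h := integrable_heatKernel_sub_mul_norm hf hG ha x
  have h' : Integrable (fun y => (fun w => heatKernel a (x - w) * ‖f w‖) (x - y)) volume :=
    (integrable_comp_sub_left (fun w => heatKernel a (x - w) * ‖f w‖) x).2 h
  refine h'.congr (Eventually.of_forall fun y => ?_)
  simp only [sub_sub_cancel]

/-- **Absolute convergence of the caloric extension at every point**: for `f` measurable and
integrable against centred Gaussians, the convolution integrand `y ↦ G_a(y) • f(x - y)` of
`e^{aΔ}f(x) = heatExtension f a x` is integrable for every `a > 0` and every `x`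
(Evans, *PDE*, §2.3.1 (12)). [folklore] -/
theorem integrable_heatKernel_smul_sub {f : E → F} (hf : AEStronglyMeasurable f volume)
    (hG : ∀ a : ℝ, 0 < a → Integrable (fun y => heatKernel a y * ‖f y‖) volume)
    {a : ℝ} (ha : 0 < a) (x : E) :
    Integrable (fun y => heatKernel a y • f (x - y)) volume := by
  refine (integrable_heatKernel_mul_norm_sub hf hG ha x).mono'
    ((continuous_heatKernel a).aestronglyMeasurable.smul
      (hf.comp_quasiMeasurePreserving (quasiMeasurePreserving_sub_left volume x)))
    (Eventually.of_forall fun y => ?_)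
  rw [norm_smul, Real.norm_of_nonneg (heatKernel_pos ha y).le]

/-- The same, as existence of the convolution `G_a ⋆ f` at every point. [folklore] -/
theorem convolutionExistsAt_heatKernel_of_integrable_heatKernel_mul_norm {f : E → F}
    (hf : AEStronglyMeasurable f volume)
    (hG : ∀ a : ℝ, 0 < a → Integrable (fun y => heatKernel a y * ‖f y‖) volume)
    {a : ℝ} (ha : 0 < a) (x : E) :
    ConvolutionExistsAt (heatKernel a) f x (ContinuousLinearMap.lsmul ℝ ℝ) volume := by
  simpa [ConvolutionExistsAt] using integrable_heatKernel_smul_sub hf hG ha x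

/-- **A.e. equal data have the same caloric extension, everywhere** (the heat extension is a
convolution integral; translation invariance of Lebesgue measure). Same statement as
`Literature.Analysis.FluidPDE.heatExtension_congr_ae` (`MildL3Smooth.lean`), placed here at the
level of `HeatKernel.lean`. [folklore] -/
theorem heatExtension_congr_ae' {f g : E → F} (hfg : f =ᵐ[volume] g) (t : ℝ) :
    heatExtension f t = heatExtension g t := by
  funext x
  rw [heatExtension_apply, heatExtension_apply]
  refine integral_congr_ae ?_
  have h : (fun y => f (x - y)) =ᵐ[volume] fun y => g (x - y) :=
    (quasiMeasurePreserving_sub_left volume x).ae_eq_comp hfg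
  filter_upwards [h] with y hy
  rw [hy]

/-- **Additivity of the caloric extension at a point of absolute convergence**: if the
convolution integrands of `e^{tΔ}f(x)` and `e^{tΔ}g(x)` are integrable then
`e^{tΔ}(f - g)(x) = e^{tΔ}f(x) - e^{tΔ}g(x)`. [folklore] -/
theorem heatExtension_sub_apply_of_integrable {f g : E → F} {t : ℝ} {x : E}
    (hf : Integrable (fun y => heatKernel t y • f (x - y)) volume)
    (hg : Integrable (fun y => heatKernel t y • g (x - y)) volume) :
    heatExtension (fun y => f y - g y) t x = heatExtension f t x - heatExtension g t x := by
  simp only [heatExtension_apply, smul_sub]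
  exact integral_sub hf hg

/-- **Additivity of the caloric extension at a point of absolute convergence** (sum). [folklore] -/
theorem heatExtension_add_apply_of_integrable {f g : E → F} {t : ℝ} {x : E}
    (hf : Integrable (fun y => heatKernel t y • f (x - y)) volume)
    (hg : Integrable (fun y => heatKernel t y • g (x - y)) volume) :
    heatExtension (fun y => f y + g y) t x = heatExtension f t x + heatExtension g t x := by
  simp only [heatExtension_apply, smul_add]
  exact integral_add hf hg

end Integrability

/-! ## The semigroup law for Gaussian-integrable data -/

section Semigroup

omit [NormedSpace ℝ F] in
/-- **The Tonelli computation behind the semigroup law**: for `f` measurable and integrable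
against centred Gaussians, `s, t > 0` and `x ∈ E`,
`∫ G_t(y) · (G_s ⋆ ‖f‖)(x - y) dy ≤ ∫ G_{t+s}(w) ‖f(x - w)‖ dw < ∞`, i.e. the iterated Gaussian
convolution of `‖f‖` converges absolutely at `x` (substitute `w = y + w'` in the inner integral,
swap, and use `G_t ⋆ G_s = G_{t+s}`, `heatKernel_convolution_heatKernel_holds`).
Evans, *PDE*, §2.3.1. [folklore] -/
theorem integrable_heatKernel_mul_convolution_norm {f : E → F} (hf : AEStronglyMeasurable f volume)
    (hG : ∀ a : ℝ, 0 < a → Integrable (fun y => heatKernel a y * ‖f y‖) volume)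
    {s t : ℝ} (hs : 0 < s) (ht : 0 < t) (x : E) :
    Integrable (fun y => ‖heatKernel t y‖ *
      ((fun w => ‖heatKernel s w‖) ⋆[ContinuousLinearMap.mul ℝ ℝ, volume] fun w => ‖f w‖)
        (x - y)) volume := by
  set H : E → ℝ := (fun w => ‖heatKernel s w‖) ⋆[ContinuousLinearMap.mul ℝ ℝ, volume]
    fun w => ‖f w‖ with hH
  have hH_apply : ∀ z, H z = ∫ w, heatKernel s w * ‖f (z - w)‖ := fun z => by
    simp only [hH, convolution_def, ContinuousLinearMap.mul_apply',
      Real.norm_of_nonneg (heatKernel_pos hs _).le]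
  have hH_nonneg : ∀ z, 0 ≤ H z := fun z => by
    rw [hH_apply]
    exact integral_nonneg fun w => mul_nonneg (heatKernel_pos hs w).le (norm_nonneg _)
  -- measurability
  have hH_meas : AEStronglyMeasurable H volume :=
    ((continuous_heatKernel s).aestronglyMeasurable.norm.convolution_integrand
      (ContinuousLinearMap.mul ℝ ℝ) hf.norm).integral_prod_right'
  have hmeas : AEStronglyMeasurable (fun y => ‖heatKernel t y‖ * H (x - y)) volume :=
    (continuous_heatKernel t).aestronglyMeasurable.norm.mul
      (hH_meas.comp_quasiMeasurePreserving (quasiMeasurePreserving_sub_left volume x))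
  refine ⟨hmeas, ?_⟩
  -- the inner integral as a lower Lebesgue integral, recentred at `x`
  have hinner : ∀ y, ENNReal.ofReal (H (x - y)) =
      ∫⁻ w, ENNReal.ofReal (heatKernel s (w - y) * ‖f (x - w)‖) := by
    intro y
    rw [hH_apply, ofReal_integral_eq_lintegral_ofReal
      (integrable_heatKernel_mul_norm_sub hf hG hs (x - y))
      (Eventually.of_forall fun w => mul_nonneg (heatKernel_pos hs w).le (norm_nonneg _)),
      ← lintegral_add_right_eq_self
        (fun w => ENNReal.ofReal (heatKernel s (w - y) * ‖f (x - w)‖)) y]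
    refine lintegral_congr fun w => ?_
    rw [add_sub_cancel_right, sub_sub, add_comm y w]
  -- joint measurability of the recentred integrand
  have hfq : AEStronglyMeasurable (fun p : E × E => f (x - p.2)) (volume.prod volume) :=
    hf.comp_quasiMeasurePreserving
      ((quasiMeasurePreserving_sub_left volume x).comp Measure.quasiMeasurePreserving_snd)
  have hjoint : AEMeasurable (uncurry fun y w : E => ENNReal.ofReal (heatKernel t y) *
      ENNReal.ofReal (heatKernel s (w - y) * ‖f (x - w)‖)) (volume.prod volume) := by
    have h1 : Measurable fun p : E × E => heatKernel t p.1 :=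
      (continuous_heatKernel t).measurable.comp measurable_fst
    have h2 : Measurable fun p : E × E => heatKernel s (p.2 - p.1) :=
      (continuous_heatKernel s).measurable.comp (measurable_snd.sub measurable_fst)
    exact h1.ennreal_ofReal.aemeasurable.mul
      ((h2.aemeasurable.mul hfq.norm.aemeasurable).ennreal_ofReal)
  -- the Gaussian convolution in `y`
  have hGG : ∀ w : E, ∫⁻ y : E, ENNReal.ofReal (heatKernel t y) * ENNReal.ofReal (heatKernel s (w - y)) =
      ENNReal.ofReal (heatKernel (t + s) w) := by
    intro w
    have hint : Integrable (fun y => heatKernel t y * heatKernel s (w - y)) volume := by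
      refine (((integrable_heatKernel_holds hs).comp_sub_left w).const_mul
        ((4 * π * t) ^ (-(Module.finrank ℝ E : ℝ) / 2))).mono'
        ((continuous_heatKernel t).aestronglyMeasurable.mul
          ((continuous_heatKernel s).comp (continuous_const.sub continuous_id)).aestronglyMeasurable)
        (Eventually.of_forall fun y => ?_)
      rw [Real.norm_of_nonneg (mul_nonneg (heatKernel_pos ht y).le (heatKernel_pos hs _).le)]
      exact mul_le_mul_of_nonneg_right (heatKernel_le ht y) (heatKernel_pos hs _).le
    have hconv := congrFun (heatKernel_convolution_heatKernel_holds (E := E) ht hs) w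
    rw [convolution_def] at hconv
    simp only [ContinuousLinearMap.lsmul_apply, smul_eq_mul] at hconv
    rw [← hconv, ofReal_integral_eq_lintegral_ofReal hint
      (Eventually.of_forall fun y => mul_nonneg (heatKernel_pos ht y).le (heatKernel_pos hs _).le)]
    refine lintegral_congr fun y => ?_
    rw [ENNReal.ofReal_mul (heatKernel_pos ht y).le]
  -- finiteness by Tonelli
  have hfin := (integrable_heatKernel_mul_norm_sub hf hG (add_pos ht hs) x).2
  rw [hasFiniteIntegral_iff_enorm] at hfin ⊢
  calc ∫⁻ y, ‖‖heatKernel t y‖ * H (x - y)‖ₑ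
      = ∫⁻ y, ENNReal.ofReal (heatKernel t y) * ENNReal.ofReal (H (x - y)) := by
        refine lintegral_congr fun y => ?_
        rw [Real.norm_of_nonneg (heatKernel_pos ht y).le, ← ofReal_norm,
          Real.norm_of_nonneg (mul_nonneg (heatKernel_pos ht y).le (hH_nonneg (x - y))),
          ENNReal.ofReal_mul (heatKernel_pos ht y).le]
    _ = ∫⁻ y, ∫⁻ w, ENNReal.ofReal (heatKernel t y) *
          ENNReal.ofReal (heatKernel s (w - y) * ‖f (x - w)‖) := by
        refine lintegral_congr fun y => ?_
        rw [hinner y, lintegral_const_mul' _ _ ENNReal.ofReal_ne_top]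
    _ = ∫⁻ w, ∫⁻ y, ENNReal.ofReal (heatKernel t y) *
          ENNReal.ofReal (heatKernel s (w - y) * ‖f (x - w)‖) := lintegral_lintegral_swap hjoint
    _ = ∫⁻ w, (∫⁻ y, ENNReal.ofReal (heatKernel t y) * ENNReal.ofReal (heatKernel s (w - y))) *
          ‖f (x - w)‖ₑ := by
        refine lintegral_congr fun w => ?_
        have hm : AEMeasurable (fun y : E => ENNReal.ofReal (heatKernel t y) *
            ENNReal.ofReal (heatKernel s (w - y))) volume :=
          ((continuous_heatKernel t).measurable.ennreal_ofReal.mul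
            (((continuous_heatKernel s).measurable.comp
              (measurable_const.sub measurable_id)).ennreal_ofReal)).aemeasurable
        rw [← lintegral_mul_const'' (‖f (x - w)‖ₑ) hm]
        refine lintegral_congr fun y => ?_
        rw [ENNReal.ofReal_mul (heatKernel_pos hs (w - y)).le, ofReal_norm, mul_assoc]
    _ = ∫⁻ w, ENNReal.ofReal (heatKernel (t + s) w) * ‖f (x - w)‖ₑ := by
        refine lintegral_congr fun w => ?_
        rw [hGG w]
    _ = ∫⁻ w, ‖heatKernel (t + s) w * ‖f (x - w)‖‖ₑ := by
        refine lintegral_congr fun w => ?_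
        rw [← ofReal_norm (heatKernel (t + s) w * ‖f (x - w)‖), norm_mul, norm_norm,
          Real.norm_of_nonneg (heatKernel_pos (add_pos ht hs) w).le,
          ENNReal.ofReal_mul (heatKernel_pos (add_pos ht hs) w).le, ofReal_norm]
    _ < ∞ := hfin

/-- **The semigroup law of the heat flow on Gaussian-integrable data**: let `f : E → F` be
a.e. strongly measurable with `∫ G_a(y) ‖f(y)‖ dy < ∞` for every `a > 0`. Then for `s, t > 0`,
`e^{tΔ}(e^{sΔ}f) = e^{(s+t)Δ}f` **everywhere** in space, all the convolution integrals involved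
being absolutely convergent (Evans, *PDE*, §2.3.1; Applebaum 2019, Thm. 3.1.4: the computation
`G_t ⋆ (G_s ⋆ f) = (G_t ⋆ G_s) ⋆ f = G_{s+t} ⋆ f`, here via `MeasureTheory.convolution_assoc`). This
is the form of the semigroup law used to restart the Navier–Stokes integral equation from a
datum that is only a tempered/Besov distribution (KNSS 2009, §4 p. 8). [cite: Evans2010, §2.3.1] -/
theorem heatExtension_heatExtension_of_integrable_heatKernel_mul_norm [CompleteSpace F]
    {f : E → F} (hf : AEStronglyMeasurable f volume)
    (hG : ∀ a : ℝ, 0 < a → Integrable (fun y => heatKernel a y * ‖f y‖) volume)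
    {s t : ℝ} (hs : 0 < s) (ht : 0 < t) :
    heatExtension (heatExtension f s) t = heatExtension f (s + t) := by
  funext x
  simp only [heatExtension]
  rw [add_comm s t, ← heatKernel_convolution_heatKernel_holds ht hs]
  symm
  refine convolution_assoc (ContinuousLinearMap.lsmul ℝ ℝ) (ContinuousLinearMap.lsmul ℝ ℝ)
    (ContinuousLinearMap.lsmul ℝ ℝ) (ContinuousLinearMap.lsmul ℝ ℝ) (fun a b v => mul_smul a b v)
    (continuous_heatKernel t).aestronglyMeasurable (continuous_heatKernel s).aestronglyMeasurable
    hf ?_ ?_ ?_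
  · -- `heatKernel t ⋆ heatKernel s` exists everywhere (`L^∞ ⋆ L¹`)
    exact Eventually.of_forall fun y => convolutionExistsAt_of_memLp (p := 1) (q := ∞) _
      (memLp_heatKernel ht le_top) (memLp_one_iff_integrable.2 (integrable_heatKernel_holds hs)) y
  · -- `|heatKernel s| ⋆ ‖f‖` exists everywhere (Gaussian integrability off centre)
    refine Eventually.of_forall fun y => ?_
    have h := integrable_heatKernel_mul_norm_sub hf hG hs y
    simp only [ConvolutionExistsAt, ContinuousLinearMap.mul_apply']
    refine h.congr (Eventually.of_forall fun w => ?_)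
    simp only [Real.norm_of_nonneg (heatKernel_pos hs w).le]
  · -- `|heatKernel t| ⋆ (|heatKernel s| ⋆ ‖f‖)` exists at `x` (Tonelli)
    have h := integrable_heatKernel_mul_convolution_norm hf hG hs ht x
    simpa only [ConvolutionExistsAt, ContinuousLinearMap.mul_apply'] using h

/-- The semigroup law at a point, in the order `e^{tΔ}(e^{sΔ}f)(x) = e^{(t+s)Δ}f(x)`. [cite: Evans2010, §2.3.1] -/
theorem heatExtension_heatExtension_apply_of_integrable_heatKernel_mul_norm [CompleteSpace F]
    {f : E → F} (hf : AEStronglyMeasurable f volume)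
    (hG : ∀ a : ℝ, 0 < a → Integrable (fun y => heatKernel a y * ‖f y‖) volume)
    {s t : ℝ} (hs : 0 < s) (ht : 0 < t) (x : E) :
    heatExtension (heatExtension f s) t x = heatExtension f (t + s) x := by
  rw [heatExtension_heatExtension_of_integrable_heatKernel_mul_norm hf hG hs ht, add_comm]

end Semigroup

end Literature.Analysis.UnboundedOperators
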